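import Mathlib
import Literature.AlgebraicGeometry.Resolution.CompletedChainNonRationalStep
import HarnessLib

/-!
# Foreign-chart exclusions for the point-step trichotomy of the completed chain (OPTION R, brick FDX)

Topic: `Literature/AlgebraicGeometry/Resolution`. V. Cossart, O. Piltant, J. Algebra 320 (2008), proof of
Lemma 4.5 (2), p. 12 («There are two charts to consider: the first one has origin the point
`x′₀ := (u₁, u₂/u₁, z/u₁)`; the second contains a unique point `x′₁ := (u₁/u₂, u₂, z/u₂)` on the strict
transform of `div(z)`») [cite: CossartPiltant2008, Lemma 4.5]; V. Cossart, U. Jannsen, S. Saito, LNM 2270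
(2020), Lemma 13.1 / (11.2) (the coordinates `(1 : 0)`, `(0 : 1)`, `(1 : λ)` of the near point)
[cite: CossartJannsenSaito2020, Lemma 13.1].

OURS (sub-brick FDX of the completed-chain descent R-5 under CONTRACT v3′ `hpt_cases`): at a point step
`φ : R → R′` the exceptional ideal `𝔪 R′` is principal; reading its generator off ONE adapted label decides
the chart for ALL labels with the same middle slot (the two affine charts overlap, but the disjuncts'
data do not: the (i′)-data put `v′ ∈ 𝔪′`, the (i)-data make it a unit). PROVED (no facts, no definitions):

* `not_ratChart_of_span_ne_map` — if `(φ c₁) ≠ 𝔪R′` then the `c₁`-chart disjunct (i)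
  `φ c₀ = φ c₁ y′ ∧ φ (c₂ − a c₁) = φ c₁ w′ ∧ (y′, φ c₁, w′) = 𝔪′` is impossible (it forces `𝔪R′ = (φ c₁)`);
* `not_oppositeVertex_of_map_eq_span` — if `𝔪R′ = (φ c₁)` then the opposite-vertex disjunct (i′)
  `φ c₀ = φ c₂ y′ ∧ φ c₁ = φ c₂ v′ ∧ (y′, v′, φ c₂) = 𝔪′` is impossible (`v′` would be a unit).

* `map_maximalIdeal_eq_span_of_oppositeVertex` — the positive twin: the (i′)-data give `𝔪R′ = (φ c₂)`;
* `hpoint_of_pointCases`, `hnonrat_of_pointCases` — the consumer shapes: from the trichotomy for ALL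
  adapted labels, the `hpoint` hypothesis of `completedChain_point_step` (when `𝔪R′ = (φ p)` and the residue
  field is onto) resp. the `hnonrat` hypothesis of `completedChain_nonRational_step` (when it is not).
The non-rational disjunct (iii) carries `¬ Function.Surjective (ResidueField.map φ)` and (i)/(i′) carry the
surjectivity, so those exclusions are propositional. F-71 / T1 / N2 NOT proved; no summit statement is
proved. AI-written; weaker than expert review.
-/

noncomputable section

open IsLocalRing

namespace Literature.AlgebraicGeometry.Resolution

universe u

section Exclusion

variable {R R' : Type u} [CommRing R] [CommRing R'] [IsLocalRing R] (φ : R →+* R')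
  (c : Fin 3 → R)
  (hgen : Ideal.span {c 0, c 1, c 2} = maximalIdeal R)

include hgen in
/-- **The `c₁`-chart disjunct forces `𝔪 R′ = (φ c₁)`**: so if `(φ c₁) ≠ 𝔪 R′` the data
`φ c₀ = φ c₁ · y′`, `φ (c₂ − a c₁) = φ c₁ · w′`, `(y′, φ c₁, w′) = 𝔪′` cannot exist.
[cite: CossartPiltant2008, Lemma 4.5 (2), p. 12] [cite: CossartJannsenSaito2020, Lemma 13.1] -/
theorem not_ratChart_of_span_ne_map [IsLocalRing R'] (hne : Ideal.span {φ (c 1)} ≠ (maximalIdeal R).map φ) :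
    ¬ ∃ (a : R) (y' w' : R'), φ (c 0) = φ (c 1) * y' ∧ φ (c 2 - a * c 1) = φ (c 1) * w' ∧
      Ideal.span {y', φ (c 1), w'} = maximalIdeal R' := by
  rintro ⟨a, y', w', h0, h2, -⟩
  apply hne
  apply le_antisymm
  · rw [Ideal.span_singleton_le_iff_mem]
    exact Ideal.mem_map_of_mem _ (hgen ▸ Ideal.subset_span (by simp))
  · rw [← hgen, Ideal.map_span, Ideal.span_le]
    rintro _ ⟨z, hz, rfl⟩
    rcases hz with rfl | rfl | rfl
    · exact Ideal.mem_span_singleton'.mpr ⟨y', by rw [h0, mul_comm]⟩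
    · exact Ideal.subset_span rfl
    · have : φ (c 2) = φ (c 1) * (w' + φ a) := by
        rw [map_sub, map_mul] at h2
        linear_combination h2
      exact Ideal.mem_span_singleton'.mpr ⟨w' + φ a, by rw [this, mul_comm]⟩

variable [IsRegularLocalRing R'] (hdim' : ringKrullDim R' = 3)

include hgen hdim' in
/-- **If `𝔪 R′ = (φ c₁)` the opposite vertex is excluded**: the data `φ c₀ = φ c₂ · y′`,
`φ c₁ = φ c₂ · v′`, `(y′, v′, φ c₂) = 𝔪′` cannot exist (`φ c₂ ∈ (φ c₁)` makes `v′` a unit, while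
`v′ ∈ 𝔪′`). [cite: CossartPiltant2008, Lemma 4.5 (2), p. 12] [cite: CossartJannsenSaito2020, Lemma 13.1] -/
theorem not_oppositeVertex_of_map_eq_span (hexc : (maximalIdeal R).map φ = Ideal.span {φ (c 1)}) :
    ¬ ∃ (y' v' : R'), φ (c 0) = φ (c 2) * y' ∧ φ (c 1) = φ (c 2) * v' ∧
      Ideal.span {y', v', φ (c 2)} = maximalIdeal R' := by
  rintro ⟨y', v', -, h1, hgen'⟩
  haveI : IsDomain R' := isDomain_of_isRegularLocalRing R'
  -- `φ c₂ ∈ 𝔪 R′ = (φ c₁)`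
  have hc2 : φ (c 2) ∈ Ideal.span {φ (c 1)} := by
    rw [← hexc]; exact Ideal.mem_map_of_mem _ (hgen ▸ Ideal.subset_span (by simp))
  obtain ⟨s, hs⟩ := Ideal.mem_span_singleton'.mp hc2
  -- `φ c₂ ≠ 0` (a member of a regular system of parameters of `R′`)
  have hgen'' : Ideal.span ({y', φ (c 2), v'} : Set R') = maximalIdeal R' := by
    rw [← hgen']; congr 1; ext z; simp only [Set.mem_insert_iff, Set.mem_singleton_iff]; tauto
  have hc2ne : φ (c 2) ≠ 0 := ne_zero_of_span_triple' hdim' hgen''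
  -- `v′` is a unit: `φ c₂ (1 − s v′) = 0`
  have hunit : IsUnit v' := by
    have h : φ (c 2) * (1 - s * v') = 0 := by
      have e1 : φ (c 2) = s * φ (c 1) := hs.symm
      have : φ (c 2) * (s * v') = s * (φ (c 2) * v') := by ring
      rw [mul_sub, mul_one, this, ← h1, ← e1, sub_self]
    rcases mul_eq_zero.mp h with h | h
    · exact absurd h hc2ne
    · exact isUnit_iff_exists_inv.mpr ⟨s, by linear_combination -h⟩
  have hv'm : v' ∈ maximalIdeal R' := hgen' ▸ Ideal.subset_span (by simp)
  exact (mem_maximalIdeal _).mp hv'm hunit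

omit [IsRegularLocalRing R'] in
include hgen in
/-- **The opposite-vertex data give `𝔪 R′ = (φ c₂)`** (positive twin of the exclusions).
[cite: CossartPiltant2008, Lemma 4.5 (2), p. 12] [cite: CossartJannsenSaito2020, Lemma 13.1] -/
theorem map_maximalIdeal_eq_span_of_oppositeVertex [IsLocalRing R']
    (h : ∃ (y' v' : R'), φ (c 0) = φ (c 2) * y' ∧ φ (c 1) = φ (c 2) * v' ∧
      Ideal.span {y', v', φ (c 2)} = maximalIdeal R') :
    (maximalIdeal R).map φ = Ideal.span {φ (c 2)} := by
  obtain ⟨y', v', h0, h1, -⟩ := h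
  apply le_antisymm
  · rw [← hgen, Ideal.map_span, Ideal.span_le]
    rintro _ ⟨z, hz, rfl⟩
    rcases hz with rfl | rfl | rfl
    · exact Ideal.mem_span_singleton'.mpr ⟨y', by rw [h0, mul_comm]⟩
    · exact Ideal.mem_span_singleton'.mpr ⟨v', by rw [h1, mul_comm]⟩
    · exact Ideal.subset_span rfl
  · rw [Ideal.span_singleton_le_iff_mem]
    exact Ideal.mem_map_of_mem _ (hgen ▸ Ideal.subset_span (by simp))

end Exclusion

/-! ## Consumer shapes: the bricks' label hypotheses from the trichotomy -/

section Consumers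

variable {R R' : Type u} [CommRing R] [CommRing R'] [IsRegularLocalRing R] [IsRegularLocalRing R']
  (φ : R →+* R') [IsLocalHom φ] (hdim' : ringKrullDim R' = 3) {I : Ideal R} {μ : ℕ}
  (hcases : ∀ c : Fin 3 → R, Ideal.span {c 0, c 1, c 2} = maximalIdeal R →
    (∀ G ∈ initialForms c I μ, ∃ a : ResidueField R, G = MvPolynomial.C a * MvPolynomial.X 0 ^ μ) →
    (Function.Surjective (ResidueField.map φ) ∧
      ∃ (a : R) (y' w' : R'), φ (c 0) = φ (c 1) * y' ∧ φ (c 2 - a * c 1) = φ (c 1) * w' ∧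
        Ideal.span {y', φ (c 1), w'} = maximalIdeal R') ∨
    (¬ Function.Surjective (ResidueField.map φ) ∧
      ∃ (t : R') (Q : Polynomial R) (y' : R'),
        φ (c 0) = φ (c 1) * y' ∧ φ (c 2) = φ (c 1) * t ∧ Q.Monic ∧
        2 ≤ (Q.map (residue R)).natDegree ∧ Irreducible (Q.map (residue R)) ∧
        (∀ G : Polynomial R, Polynomial.eval₂ φ t G ∈ maximalIdeal R' ↔
          Q.map (residue R) ∣ G.map (residue R)) ∧
        (∀ r : ResidueField R', ∃ G : Polynomial R, residue R' (Polynomial.eval₂ φ t G) = r) ∧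
        Ideal.span {y', φ (c 1), Polynomial.eval₂ φ t Q} = maximalIdeal R') ∨
    (Function.Surjective (ResidueField.map φ) ∧
      ∃ (y' v' : R'), φ (c 0) = φ (c 2) * y' ∧ φ (c 1) = φ (c 2) * v' ∧
        Ideal.span {y', v', φ (c 2)} = maximalIdeal R'))

include hdim' hcases in
/-- **`hpoint` of `completedChain_point_step` from the trichotomy**, when `𝔪 R′ = (φ p)` and the residue
field is onto. [cite: CossartPiltant2008, Lemma 4.5 (2), p. 12] [cite: CossartJannsenSaito2020, Lemma 13.1] -/
theorem hpoint_of_pointCases (p : R) (hm : (maximalIdeal R).map φ = Ideal.span {φ p})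
    (hsurj : Function.Surjective (ResidueField.map φ)) :
    ∀ (y w : R), Ideal.span {y, p, w} = maximalIdeal R →
      (∀ G ∈ initialForms ![y, p, w] I μ, ∃ a : ResidueField R, G = MvPolynomial.C a * MvPolynomial.X 0 ^ μ) →
      ∃ (a : R) (y' w' : R'), φ y = φ p * y' ∧ φ (w - a * p) = φ p * w' ∧
        Ideal.span {y', φ p, w'} = maximalIdeal R' := by
  intro y w hg had
  rcases hcases ![y, p, w] (by simpa using hg) had with ⟨-, h⟩ | ⟨hns, -⟩ | ⟨-, h⟩
  · simpa using h
  · exact absurd hsurj hns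
  · exfalso
    exact not_oppositeVertex_of_map_eq_span φ ![y, p, w] (by simpa using hg) hdim' (by simpa using hm)
      (by simpa using h)

include hcases in
/-- **`hnonrat` of `completedChain_nonRational_step` from the trichotomy**, when the residue field is not
onto. [cite: CossartPiltant2008, Lemma 4.5 (2), p. 12] [cite: CossartJannsenSaito2020, Lemma 14.1] -/
theorem hnonrat_of_pointCases (p : R) (hns : ¬ Function.Surjective (ResidueField.map φ)) :
    ∀ (y w : R), Ideal.span {y, p, w} = maximalIdeal R →
      (∀ G ∈ initialForms ![y, p, w] I μ, ∃ a : ResidueField R, G = MvPolynomial.C a * MvPolynomial.X 0 ^ μ) →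
      ∃ (t : R') (Q : Polynomial R) (y' : R'),
        φ y = φ p * y' ∧ φ w = φ p * t ∧ Q.Monic ∧
        2 ≤ (Q.map (residue R)).natDegree ∧ Irreducible (Q.map (residue R)) ∧
        (∀ G : Polynomial R, Polynomial.eval₂ φ t G ∈ maximalIdeal R' ↔
          Q.map (residue R) ∣ G.map (residue R)) ∧
        (∀ r : ResidueField R', ∃ G : Polynomial R, residue R' (Polynomial.eval₂ φ t G) = r) ∧
        Ideal.span {y', φ p, Polynomial.eval₂ φ t Q} = maximalIdeal R' := by
  intro y w hg had
  rcases hcases ![y, p, w] (by simpa using hg) had with ⟨hs, -⟩ | ⟨-, h⟩ | ⟨hs, -⟩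
  · exact absurd hs hns
  · simpa using h
  · exact absurd hs hns

end Consumers

end Literature.AlgebraicGeometry.Resolution

end
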